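import Literature.AnabelianGeometry.AbsoluteAnabelian.AbsAnabFundamentalGroups
import Literature.AnabelianGeometry.AbsoluteAnabelian.MLFGaloisGroupsProofs
import HarnessLib

/-!
# [AbsAnab] §1.3 p. 19: "Lemma 1.3.8, Proposition 1.2.1, (v), imply that `q₁ = q₂`" — the printed
# deduction, relative to local class field theory

S. Mochizuki, *The Absolute Anabelian Geometry of Hyperbolic Curves* (2004) [AbsAnab], §1.3
p. 19 (manuscript pagination, lit key paper:url-e8f118cc205e), the sentence between Lemmas 1.3.8
and 1.3.9: for hyperbolic curves `(Xᵢ)_{Kᵢ}` over finite extensions `Kᵢ/ℚ_{pᵢ}` and an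
isomorphism `α : Π_{(X₁)_{K₁}} ≅ Π_{(X₂)_{K₂}}`, once `α` is compatible with the quotients
`Π ↠ G_{Kᵢ}` (Lemma 1.3.8), Prop 1.2.1 (v) gives `q₁ = q₂` for the residue cardinalities
([IUTchI] p. 79 cites Prop 1.2.1 (v) in this role).  abc-iut-L4-t4's
`AbsAnabFundamentalGroups.lean` types the conclusion as the predicate
`FundamentalExtension.SameResidueCard B₁ B₂` on MLF base data and the hypothesis as
`FundamentalExtension.PreservesGeom α`.

This proof-only companion kernel-checks the deduction
(`sameResidueCard_of_preservesGeom`): an isomorphism of profinite groups `Π₁ ≅ Π₂` carrying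
`Δ₁` onto `Δ₂` induces a bicontinuous isomorphism `G_{K₁} ≅ G_{K₂}` (continuity: `Πᵢ ↠ Gᵢ` are
quotient maps of compact groups), to which Prop 1.2.1 (v) — in the conditional form
`galoisMLF_iso_degrees_of_rank_of_torsion` of `MLFGaloisGroupsProofs.lean`, i.e. GIVEN the LCFT
rank formula `hR` and torsion count `hT` — applies.

Proof-only: no definition is introduced; nothing of the statement files is restated.  HONEST
FRAMING: a CONDITIONAL discharge (LCFT inputs are hypotheses); no bearing on Cor. 3.12.
-/

noncomputable section

namespace Literature.AnabelianGeometry.AbsoluteAnabelian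

open Field

namespace FundamentalExtension

variable {E F : FundamentalExtension.{0}}

/-- The isomorphism `G₁ ≅ G₂` induced by a `Δ`-preserving `α : Π₁ ≅ Π₂` is compatible with the
augmentations: `ᾱ(aug₁ x) = aug₂(α x)`. [cite: MochizukiAbsAnab2004, Lemma 1.3.8 p.18] -/
theorem PreservesGeom.galEquiv_aug {α : E.arith ≃ₜ* F.arith} (hα : PreservesGeom α)
    (x : E.arith) : hα.galEquiv (E.aug x) = F.aug (α x) := by
  unfold PreservesGeom.galEquiv
  rw [MulEquiv.trans_apply, MulEquiv.trans_apply]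
  have h1 : E.quotientGeomEquivGal.symm (E.aug x) = QuotientGroup.mk x := by
    rw [MulEquiv.symm_apply_eq]
    rfl
  rw [h1]
  rfl

/-- The isomorphism `G₁ ≅ G₂` induced by a `Δ`-preserving bicontinuous `α : Π₁ ≅ Π₂` is
bicontinuous (`Πᵢ ↠ Gᵢ` being quotient maps of compact Hausdorff groups): "`α` induces
isomorphisms `Δ₁ ≅ Δ₂`, `G₁ ≅ G₂`" as profinite groups.
[cite: MochizukiAbsAnab2004, Lemma 1.3.8 p.18] -/
theorem PreservesGeom.exists_continuousMulEquiv_gal {α : E.arith ≃ₜ* F.arith}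
    (hα : PreservesGeom α) :
    ∃ β : E.gal ≃ₜ* F.gal, ∀ x : E.arith, β (E.aug x) = F.aug (α x) := by
  have hqE : Topology.IsQuotientMap E.aug :=
    ((map_continuous E.aug).isClosedMap).isQuotientMap (map_continuous E.aug) E.aug_surjective
  have hqF : Topology.IsQuotientMap F.aug :=
    ((map_continuous F.aug).isClosedMap).isQuotientMap (map_continuous F.aug) F.aug_surjective
  have hcomp : (hα.galEquiv : E.gal → F.gal) ∘ E.aug = F.aug ∘ α :=
    funext fun x => hα.galEquiv_aug x
  have hcomp' : (hα.galEquiv.symm : F.gal → E.gal) ∘ F.aug = E.aug ∘ α.symm := by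
    funext y
    change hα.galEquiv.symm (F.aug y) = E.aug (α.symm y)
    rw [MulEquiv.symm_apply_eq, hα.galEquiv_aug, ContinuousMulEquiv.apply_symm_apply]
  refine ⟨{ hα.galEquiv with
      continuous_toFun := ?_
      continuous_invFun := ?_ }, fun x => hα.galEquiv_aug x⟩
  · change Continuous (hα.galEquiv : E.gal → F.gal)
    rw [hqE.continuous_iff, hcomp]
    exact (map_continuous F.aug).comp (map_continuous α)
  · change Continuous (hα.galEquiv.symm : F.gal → E.gal)
    rw [hqF.continuous_iff, hcomp']
    exact (map_continuous E.aug).comp (map_continuous α.symm)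

/-- **[AbsAnab] §1.3 p. 19, "Thus, Lemma 1.3.8, Proposition 1.2.1, (v), imply that `q₁ = q₂`"**,
the printed deduction kernel-checked: for extensions `Πᵢ` with MLF base data `Gᵢ ≅ G_{Kᵢ}` and a
bicontinuous isomorphism `α : Π₁ ≅ Π₂` compatible with the quotients `Πᵢ ↠ Gᵢ`
(`PreservesGeom α`, the conclusion of Lemma 1.3.8), the residue fields of `K₁`, `K₂` have the same
cardinality — GIVEN Prop 1.2.1 (v) in its conditional form, i.e. the LCFT rank formula `hR` and
torsion count `hT` of `MLFGaloisGroupsProofs.lean`. [cite: MochizukiAbsAnab2004, §1.3 p.19] -/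
theorem sameResidueCard_of_preservesGeom
    (hR : ∀ (p : ℕ) [Fact p.Prime] (K : Type) [Field K] [Algebra ℚ_[p] K]
      [FiniteDimensional ℚ_[p] K],
      (∀ (l : ℕ) [Fact l.Prime], l ≠ p → freeProlRank (absoluteGaloisGroup K) l = 1) ∧
        freeProlRank (absoluteGaloisGroup K) p = (Module.finrank ℚ_[p] K + 1 : ℕ))
    (hT : ∀ (p : ℕ) [Fact p.Prime] (K : Type) [Field K] [Algebra ℚ_[p] K]
      [FiniteDimensional ℚ_[p] K],
      Nat.card (primeToRootsOfUnity p (absoluteGaloisGroupAbelianization K)) =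
        Nat.card (primeToRootsOfUnity p K))
    (B₁ : E.MLFBase) (B₂ : F.MLFBase) {α : E.arith ≃ₜ* F.arith} (hα : PreservesGeom α) :
    SameResidueCard B₁ B₂ := by
  letI := B₁.instPrime; letI := B₁.instField; letI := B₁.instAlgebra; letI := B₁.instFinite
  letI := B₂.instPrime; letI := B₂.instField; letI := B₂.instAlgebra; letI := B₂.instFinite
  obtain ⟨β, -⟩ := hα.exists_continuousMulEquiv_gal
  let γ : absoluteGaloisGroup B₁.K ≃ₜ* absoluteGaloisGroup B₂.K :=
    (B₁.galIso.symm.trans β).trans B₂.galIso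
  have h := (galoisMLF_iso_degrees_of_rank_of_torsion hR hT B₁.p B₂.p B₁.K B₂.K ⟨γ⟩).2
  unfold residueCardMLF at h
  have h' := Nat.add_right_cancel h
  exact h'

end FundamentalExtension

end Literature.AnabelianGeometry.AbsoluteAnabelian
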